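import Literature.Topology.FourManifolds.SphereFamilySurgery
import Literature.Topology.FourManifolds.SphereInHomotopyFourSphereTube
import Literature.Topology.FourManifolds.HomotopyS4CompactProofs
import Literature.Topology.FourManifolds.ComplexProjectiveSpaceProofs
import Literature.Topology.FourManifolds.KnotFraming
import Literature.Geometry.Manifold.OpenEmbeddingCriterion
import Mathlib.Geometry.Manifold.LocalDiffeomorph
import Mathlib.Topology.Homotopy.Equiv

/-!
# Crux `WeakReductionDescent.DependentTripleGenusThreeStandard` (stmt-SmoothPoincare4-18000), line
# `Sketch`: an embedded `2`-sphere in a homotopy `4`-sphere is the core of a framed sphere family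

Helper file (`--supports stmt-SmoothPoincare4-18000`) of the registered skeleton
`Cruxes/DependentTripleGenusThreeStandard/Lines/Sketch.lean`: a piece of the apex stub's cap-sphere
road.  To surger the cap sphere one needs a framing of its normal bundle; in a homotopy `4`-sphere
every embedded `2`-sphere is null-homotopic, hence has a trivial normal bundle (R. C. Kirby,
*The Topology of 4-Manifolds* (1989), Ch. VIII, Thm. 2, pp. 44–45).

* `helper_exists_framedSphereFamily_of_homotopySphere` (REGISTERED helper) — for `M ≃ₕ S⁴` a smooth
  `4`-manifold and `q : S² → M` a `C^∞` embedding there is a one-member framed sphere family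
  `ν : FramedSphereFamily (𝓡 4) M Unit 2 2` (a `C^∞` open embedding `S² × ℝ² ↪ M`) whose core
  sphere is `q`.

Proof: the tree PROVES the statement for the Riemann sphere `ℂℙ¹`
(`Literature.Topology.FourManifolds.exists_framedTube_of_homotopyEquiv_sphere_four`,
`SphereInHomotopyFourSphereTube.lean`: Whitney embedding, rotation field of the normal planes,
null-homotopy off the image, Kirby's transport argument); we transport it along the tree's
diffeomorphism `ℂℙ¹ ≅ S²` (`nonempty_diffeomorph_complexProjectiveSpace_one_sphere_holds`): the
composite `q ∘ Φ : ℂℙ¹ → M` is a smooth injective immersion, its framed tube `ν′ : ℂℙ¹ × ℝ² ↪ M`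
reparametrised by `Φ⁻¹ × id` (`Literature.Geometry.Manifold.isSmoothEmbedding_comp_of_inverse`) is
the required open embedding `S² × ℝ² ↪ M` with zero section `q`.  `M` is compact by
`compactSpace_of_homotopyEquiv_sphere_four_holds`.

No new definition, no named fact; pure assembly of proved tree theorems.

References: R. C. Kirby, *The Topology of 4-Manifolds*, LNM 1374 (1989), Ch. VIII, Thm. 2,
pp. 44–45; J. Milnor, *Lectures on the h-cobordism theorem* (1965), Def. 3.9, §3 p. 21.
-/

-- the registered namespace `Summit.SmoothPoincare4.SmoothPoincare4.Theorems…` repeats a component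
set_option linter.dupNamespace false

noncomputable section

open scoped Manifold ContDiff Topology ContinuousMap
open Set Function
open Literature.Topology.FourManifolds

namespace Summit.SmoothPoincare4.SmoothPoincare4.Theorems

/-- **A smooth embedding precomposed with a diffeomorphism is a smooth injective immersion.**
For `q : S² → M` a `C^∞` embedding and `Φ : ℂℙ¹ ≅ S²`, the composite `q ∘ Φ` is `C^∞`, injective,
with injective differential everywhere. [folklore] -/
theorem contMDiff_injective_mfderiv_comp_diffeomorph
    {M : Type*} [TopologicalSpace M] [ChartedSpace (EuclideanSpace ℝ (Fin 4)) M]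
    [IsManifold (𝓡 4) ∞ M]
    (q : Metric.sphere (0 : EuclideanSpace ℝ (Fin 3)) 1 → M)
    (hq : Manifold.IsSmoothEmbedding (𝓡 2) (𝓡 4) ∞ q)
    (Φ : ComplexProjectiveSpace 1 ≃ₘ⟮𝓡 2, 𝓡 2⟯ (Metric.sphere (0 : EuclideanSpace ℝ (Fin 3)) 1)) :
    ContMDiff (𝓡 2) (𝓡 4) ∞ (q ∘ Φ) ∧ Injective (q ∘ Φ) ∧
      ∀ y, Injective (mfderiv (𝓡 2) (𝓡 4) (q ∘ Φ) y) := by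
  refine ⟨hq.contMDiff.comp Φ.contMDiff, hq.isEmbedding.injective.comp Φ.injective, fun y => ?_⟩
  have hqd : MDifferentiableAt (𝓡 2) (𝓡 4) q (Φ y) :=
    hq.contMDiff.mdifferentiableAt (by simp)
  have hΦd : MDifferentiableAt (𝓡 2) (𝓡 2) Φ y := Φ.contMDiff.mdifferentiableAt (by simp)
  rw [mfderiv_comp y hqd hΦd]
  have hA : Injective (mfderiv (𝓡 2) (𝓡 4) q (Φ y)) :=
    Manifold.IsImmersionAt.mfderiv_injective (hq.isImmersion.isImmersionAt _) (by simp)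
  have hB : Injective (mfderiv (𝓡 2) (𝓡 2) Φ y) := by
    rw [← Diffeomorph.mfderivToContinuousLinearEquiv_coe Φ (by simp)]
    exact (Φ.mfderivToContinuousLinearEquiv (by simp) y).injective
  exact fun v w hvw => hB (hA hvw)

/-- **REGISTERED helper of crux stmt-SmoothPoincare4-18000 (line `Sketch`): an embedded `2`-sphere
in a homotopy `4`-sphere is the core sphere of a one-member framed sphere family** (Kirby's
Theorem VIII.2 — a null-homologous oriented codimension-two submanifold has a trivial normal
bundle — for `2`-spheres in homotopy `4`-spheres, where both hypotheses are automatic; in the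
tree's surgery vocabulary `FramedSphereFamily (𝓡 4) M Unit 2 2` of Milnor's characteristic
embeddings `S² × ℝ² ↪ M`).  Proof: the tree's framed tube of an embedded Riemann sphere
(`exists_framedTube_of_homotopyEquiv_sphere_four`) transported along `ℂℙ¹ ≅ S²`.
[cite: Kirby1989, Ch. VIII, Thm. 2, pp. 44–45] -/
theorem helper_exists_framedSphereFamily_of_homotopySphere :
    ∀ (M : Type) [TopologicalSpace M] [T2Space M] [SecondCountableTopology M]
      [ChartedSpace (EuclideanSpace ℝ (Fin 4)) M] [IsManifold (𝓡 4) ∞ M],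
      M ≃ₕ (Metric.sphere (0 : EuclideanSpace ℝ (Fin 5)) 1) →
      ∀ q : Metric.sphere (0 : EuclideanSpace ℝ (Fin 3)) 1 → M,
        Manifold.IsSmoothEmbedding (𝓡 2) (𝓡 4) ∞ q →
        ∃ ν : FramedSphereFamily (𝓡 4) M Unit 2 2, ν.sphere () = q := by
  intro M _ _ _ _ _ e q hq
  haveI : CompactSpace M := compactSpace_of_homotopyEquiv_sphere_four_holds M e
  -- the tree's diffeomorphism `Φ : ℂℙ¹ ≅ S²`
  obtain ⟨Φ⟩ : Nonempty (ComplexProjectiveSpace 1 ≃ₘ⟮𝓡 2, 𝓡 2⟯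
      (Metric.sphere (0 : EuclideanSpace ℝ (Fin 3)) 1)) :=
    nonempty_diffeomorph_complexProjectiveSpace_one_sphere_holds
  -- the embedded Riemann sphere `c = q ∘ Φ` and its framed tube
  obtain ⟨hc, hci, hdc⟩ := contMDiff_injective_mfderiv_comp_diffeomorph q hq Φ
  obtain ⟨ν', hν', hν'o, hν'0⟩ :=
    exists_framedTube_of_homotopyEquiv_sphere_four ⟨e⟩ (q ∘ Φ) hc hci hdc
  -- reparametrise the tube by `Φ⁻¹ × id`
  let Ψ : (Metric.sphere (0 : EuclideanSpace ℝ (Fin 3)) 1 × EuclideanSpace ℝ (Fin 2)) ≃ₘ⟮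
      (𝓡 2).prod 𝓘(ℝ, EuclideanSpace ℝ (Fin 2)), (𝓡 2).prod 𝓘(ℝ, EuclideanSpace ℝ (Fin 2))⟯
      (ComplexProjectiveSpace 1 × EuclideanSpace ℝ (Fin 2)) :=
    Φ.symm.prodCongr (Diffeomorph.refl 𝓘(ℝ, EuclideanSpace ℝ (Fin 2)) (EuclideanSpace ℝ (Fin 2)) ∞)
  have L : (EuclideanSpace ℝ (Fin 2) × EuclideanSpace ℝ (Fin 2)) ≃L[ℝ] EuclideanSpace ℝ (Fin 4) :=
    ContinuousLinearEquiv.ofFinrankEq (by simp)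
  obtain ⟨hν, hνo, -⟩ := Literature.Geometry.Manifold.isSmoothEmbedding_comp_of_inverse
    (I := 𝓡 4) hν' hν'o (φ := Ψ) Ψ.contMDiff Ψ.injective Ψ.toHomeomorph.isOpenMap
    (φinv := Ψ.symm) Ψ.symm.contMDiff.contMDiffOn (fun z => Ψ.symm_apply_apply z) L
  refine ⟨⟨fun _ => ν' ∘ Ψ, fun _ => hν, fun _ => hνo, fun i j hij => absurd (Subsingleton.elim i j) hij⟩,
    ?_⟩
  funext v
  show ν' (Ψ (v, 0)) = q v
  have hΨ : Ψ (v, 0) = (Φ.symm v, 0) := rfl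
  rw [hΨ, hν'0, comp_apply, Diffeomorph.apply_symm_apply]

end Summit.SmoothPoincare4.SmoothPoincare4.Theorems

end
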